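import Summits.QuantumFields.YangMills.Theorems.PoincareLipschitzFlatRieszLog

/-!
# The consumer shape of the flat Riesz-log bound: a per-bond chart from `ℓ²`-mass plus bounded divergence-form data

Sequel to `PoincareLipschitzFlatRieszLog` (the `ℓ^∞ → BMO → ℓ^∞(log)` bound for the lattice Riesz transform `∇Δ⁻¹∂*` on `ℤ^d`).
There the output is `|∂_μu(x) − avg_{Q_N(x)}∂_μu| ≤ (log₂(N+1)+1)·√(2^d)·M` for any `M` dominating the top-scale excess and the
data. Here we put it in the shape a consumer holding only

* the equation `−Δu = ∂*g` with `|g| ≤ m` on `Q_{N+2}(x)` (bounded DIVERGENCE-FORM data), and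
* an `ℓ²` bound `Σ_{Q_N(x)} |∂_μu|² ≤ E` (global quadratic "mass" on the box)

wants: `|∂_μu(x)| ≤ K_d·(log₂(N+1)+1)·(m + √(E∕(N+1)^d))` (`exists_abs_fdiff_le_log_of_dvg`), with an explicit intermediate form
(`abs_fdiff_le_log_of_dvg_of_sum_sq`). The two elementary inputs are `|avg_{Q_N} f| ≤ √(E∕(N+1)^d)` (`abs_boxAvg_le_sqrt`, Cauchy–Schwarz
with `#Q_N = (2N+1)^d ≥ (N+1)^d`, `pow_succ_le_card_box`) and `exc ≤ Σ f²`.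

This is flat `ℤ^d` potential theory (the abelian model); no gauge field, covariance or multiscale structure enters.
[folklore] [cite: Giaquinta1984, Ch. III §3 Thm 3.1 p.84, §1 Thm 1.2 p.70]
-/

open scoped BigOperators
open Finset

namespace Summit.QuantumFields.YangMills.Theorems.PoincareLipschitzFlatRieszLogSup

open Literature.MathematicalPhysics.QuantumFieldTheory.Balaban1983to89
open B4Eq19LatticeOperators B4Eq19LatticeBoxMeans
open Summit.QuantumFields.YangMills.Theorems.PoincareLipschitzFlatRieszLog (abs_fdiff_sub_boxAvg_le_log_of_dvg)

variable {d : ℕ}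

/-! ## §1 Elementary inputs -/

/-- `(N+1)^d ≤ #Q_N(x) = (2N+1)^d` for `N ≥ 0`. [folklore] -/
theorem pow_succ_le_card_box (x : Zd d) {N : ℤ} (hN : 0 ≤ N) : ((N : ℝ) + 1) ^ d ≤ ((box x N).card : ℝ) := by
  rw [card_box x hN]
  push_cast
  have hN' : (0 : ℝ) ≤ N := by exact_mod_cast hN
  exact pow_le_pow_left₀ (by linarith) (by linarith) d

/-- ★ **THE MEAN IS CONTROLLED BY THE `ℓ²`-MASS**: `N ≥ 0`, `Σ_{Q_N(x)} f² ≤ E` ⟹ `|avg_{Q_N(x)} f| ≤ √(E∕(N+1)^d)`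
(Cauchy–Schwarz `#Q·avg² ≤ Σ f²` and `#Q_N ≥ (N+1)^d`). [folklore] -/
theorem abs_boxAvg_le_sqrt (f : Zd d → ℝ) (x : Zd d) {N : ℤ} (hN : 0 ≤ N) {E : ℝ} (hE : ∑ y ∈ box x N, f y ^ 2 ≤ E) :
    |boxAvg f x N| ≤ Real.sqrt (E / ((N : ℝ) + 1) ^ d) := by
  have hN' : (0 : ℝ) ≤ N := by exact_mod_cast hN
  have hpos : (0 : ℝ) < ((N : ℝ) + 1) ^ d := by positivity
  have hc := pow_succ_le_card_box x hN
  have h1 := card_mul_boxAvg_sq_le f x N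
  have h2 : boxAvg f x N ^ 2 ≤ E / ((N : ℝ) + 1) ^ d := by
    rw [le_div_iff₀ hpos]
    calc boxAvg f x N ^ 2 * (((N : ℝ) + 1) ^ d) ≤ boxAvg f x N ^ 2 * ((box x N).card : ℝ) :=
          mul_le_mul_of_nonneg_left hc (sq_nonneg _)
      _ ≤ ∑ y ∈ box x N, f y ^ 2 := by rw [mul_comm]; exact h1
      _ ≤ E := hE
  calc |boxAvg f x N| = Real.sqrt (boxAvg f x N ^ 2) := (Real.sqrt_sq_eq_abs _).symm
    _ ≤ Real.sqrt (E / ((N : ℝ) + 1) ^ d) := Real.sqrt_le_sqrt h2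

/-! ## §2 The chart from `ℓ²`-mass and bounded divergence-form data -/

/-- ★★ **EXPLICIT FORM**: `d ≥ 1`, `N ≥ 0`; `−Δu = ∂*g`, `|g| ≤ m` on `Q_{N+2}(x)`; `Σ_{Q_N(x)}|∂_μu|² ≤ E`. Then
`|∂_μu(x)| ≤ √(E∕(N+1)^d) + (log₂(N+1)+1)·√(2^d)·√(C₁·E∕(N+1)^d + C₂·m²)` with the explicit `C₁ = (4A)^d`,
`C₂ = (4∕3)(4A)^{2d}(4A₁+2)·d·5^d` of `PoincareLipschitzFlatRieszLog.abs_fdiff_sub_boxAvg_le_log_of_dvg` (`M := √(C₁E∕(N+1)^d + C₂m²)`,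
`exc ≤ Σ|∂_μu|² ≤ E`, plus `abs_boxAvg_le_sqrt` for the mean). [folklore] [cite: Giaquinta1984, Ch. III §3 Thm 3.1 p.84] -/
theorem abs_fdiff_le_log_of_dvg_of_sum_sq (hd : 1 ≤ d) (u : Zd d → ℝ) (g : Zd d → Fin d → ℝ) (x : Zd d) {m : ℝ} {N : ℤ} (hN : 0 ≤ N)
    (hEq : ∀ y ∈ box x (N + 2), lop 0 u y = dvg g y) (hg : ∀ y ∈ box x (N + 2), ∀ ν, |g y ν| ≤ m) (μ : Fin d) {E : ℝ}
    (hE : ∑ y ∈ box x N, fdiff μ u y ^ 2 ≤ E) :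
    |fdiff μ u x| ≤ Real.sqrt (E / ((N : ℝ) + 1) ^ d) + ((Nat.log 2 (N + 1).toNat : ℝ) + 1) * (Real.sqrt ((2 : ℝ) ^ d) *
      Real.sqrt ((4 * (4 * 2 ^ (d + 1) * ((4 : ℝ) ^ d * d ^ 2 * (1 + 56 * d) ^ d * ((2 : ℝ) ^ d * (1 + 56 * d) ^ d * (8 * ((d : ℝ) + 1)) ^ (d + 1)) *
          (896 * d * (12 * (d : ℝ) + 8) ^ d) + (12 * (d : ℝ) + 8) ^ (d + 2)))) ^ d * (E / ((N : ℝ) + 1) ^ d) +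
      4 / 3 * (4 * (4 * 2 ^ (d + 1) * ((4 : ℝ) ^ d * d ^ 2 * (1 + 56 * d) ^ d * ((2 : ℝ) ^ d * (1 + 56 * d) ^ d * (8 * ((d : ℝ) + 1)) ^ (d + 1)) *
          (896 * d * (12 * (d : ℝ) + 8) ^ d) + (12 * (d : ℝ) + 8) ^ (d + 2)))) ^ (2 * d) *
        ((4 * ((4 : ℝ) ^ d * d ^ 2 * (1 + 56 * d) ^ d * ((2 : ℝ) ^ d * (1 + 56 * d) ^ d * (8 * ((d : ℝ) + 1)) ^ (d + 1)) *
          (896 * d * (12 * (d : ℝ) + 8) ^ d) + (12 * (d : ℝ) + 8) ^ (d + 2)) + 2) * ((d : ℝ) * 5 ^ d * m ^ 2)))) := by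
  set A₁ : ℝ := (4 : ℝ) ^ d * d ^ 2 * (1 + 56 * d) ^ d * ((2 : ℝ) ^ d * (1 + 56 * d) ^ d * (8 * ((d : ℝ) + 1)) ^ (d + 1)) *
          (896 * d * (12 * (d : ℝ) + 8) ^ d) + (12 * (d : ℝ) + 8) ^ (d + 2) with hA₁
  have hA₁0 : 0 ≤ A₁ := by positivity
  have hN' : (0 : ℝ) ≤ N := by exact_mod_cast hN
  have hpos : (0 : ℝ) < ((N : ℝ) + 1) ^ d := by positivity
  -- `E ≥ 0` and `exc ≤ E`
  have hE0 : 0 ≤ E := (Finset.sum_nonneg fun _ _ => sq_nonneg _).trans hE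
  have hexc : exc (fdiff μ u) x N ≤ E := (exc_le_sum_sq _ _ _).trans hE
  set C₁ : ℝ := (4 * (4 * 2 ^ (d + 1) * A₁)) ^ d with hC₁
  set C₂m : ℝ := 4 / 3 * (4 * (4 * 2 ^ (d + 1) * A₁)) ^ (2 * d) * ((4 * A₁ + 2) * ((d : ℝ) * 5 ^ d * m ^ 2)) with hC₂m
  have hC₁0 : 0 ≤ C₁ := by positivity
  have hC₂m0 : 0 ≤ C₂m := by positivity
  set M : ℝ := Real.sqrt (C₁ * (E / ((N : ℝ) + 1) ^ d) + C₂m) with hM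
  have hM0 : 0 ≤ M := Real.sqrt_nonneg _
  have hMbig : C₁ * (exc (fdiff μ u) x N / ((N : ℝ) + 1) ^ d) + C₂m ≤ M ^ 2 := by
    rw [hM, Real.sq_sqrt (by positivity)]
    have h1 : exc (fdiff μ u) x N / ((N : ℝ) + 1) ^ d ≤ E / ((N : ℝ) + 1) ^ d := div_le_div_of_nonneg_right hexc hpos.le
    have h2 := mul_le_mul_of_nonneg_left h1 hC₁0
    linarith only [h2]
  have h := abs_fdiff_sub_boxAvg_le_log_of_dvg hd u g x hN hEq hg μ hM0 (by rw [← hA₁, ← hC₁, ← hC₂m]; exact hMbig)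
  have havg := abs_boxAvg_le_sqrt (fdiff μ u) x hN hE
  have htri : |fdiff μ u x| ≤ |fdiff μ u x - boxAvg (fdiff μ u) x N| + |boxAvg (fdiff μ u) x N| := by
    have := abs_add_le (fdiff μ u x - boxAvg (fdiff μ u) x N) (boxAvg (fdiff μ u) x N)
    simpa using this
  clear_value A₁ C₁ C₂m M
  linarith only [h, havg, htri]

/-- ★★★ **THE CHART FROM `ℓ²`-MASS AND BOUNDED DIVERGENCE-FORM DATA, AT THE PRICE OF THE NUMBER OF SCALES**: for every `d ≥ 1` there is an
explicit `K = K_d > 0` such that: `N ≥ 0`, `−Δu = ∂*g` with `|g| ≤ m` on `Q_{N+2}(x)`, `Σ_{Q_N(x)}|∂_μu|² ≤ E` ⟹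
`|∂_μu(x)| ≤ K·(log₂(N+1)+1)·(m + √(E∕(N+1)^d))`. (`K = 1 + √(2^d)·(√C₁ + √C₂')`, `C₂ = C₂'·m²`, by `√(a+b) ≤ √a+√b` and
`log₂(N+1)+1 ≥ 1`.) The abelian (flat `ℤ^d`) model of «per-bond chart ⟸ quadratic mass on the box + the equation»; the logarithm is
the BMO-to-`ℓ^∞` loss of the Riesz transform and cannot be removed at this generality. [folklore]
[cite: Giaquinta1984, Ch. III §3 Thm 3.1 p.84, §1 Thm 1.2 p.70] -/
theorem exists_abs_fdiff_le_log_of_dvg (hd : 1 ≤ d) : ∃ K : ℝ, 0 < K ∧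
    ∀ (u : Zd d → ℝ) (g : Zd d → Fin d → ℝ) (x : Zd d) (m : ℝ) (N : ℤ), 0 ≤ N →
      (∀ y ∈ box x (N + 2), lop 0 u y = dvg g y) → (∀ y ∈ box x (N + 2), ∀ ν, |g y ν| ≤ m) →
      ∀ (μ : Fin d) (E : ℝ), ∑ y ∈ box x N, fdiff μ u y ^ 2 ≤ E →
        |fdiff μ u x| ≤ K * (((Nat.log 2 (N + 1).toNat : ℝ) + 1) * (m + Real.sqrt (E / ((N : ℝ) + 1) ^ d))) := by
  -- `√(a+b) ≤ √a + √b` (also in the tree as `MRT2015.sqrt_add_le_sqrt_add_sqrt`; three lines here keep the imports flat)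
  have hab : ∀ a b : ℝ, 0 ≤ a → 0 ≤ b → Real.sqrt (a + b) ≤ Real.sqrt a + Real.sqrt b := fun a b ha hb => by
    rw [Real.sqrt_le_iff]
    refine ⟨by positivity, ?_⟩
    have e : (Real.sqrt a + Real.sqrt b) ^ 2 = a + b + 2 * (Real.sqrt a * Real.sqrt b) := by
      rw [add_sq, Real.sq_sqrt ha, Real.sq_sqrt hb]; ring
    rw [e]
    linarith only [mul_nonneg (Real.sqrt_nonneg a) (Real.sqrt_nonneg b)]
  set A₁ : ℝ := (4 : ℝ) ^ d * d ^ 2 * (1 + 56 * d) ^ d * ((2 : ℝ) ^ d * (1 + 56 * d) ^ d * (8 * ((d : ℝ) + 1)) ^ (d + 1)) *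
          (896 * d * (12 * (d : ℝ) + 8) ^ d) + (12 * (d : ℝ) + 8) ^ (d + 2) with hA₁
  have hA₁0 : 0 ≤ A₁ := by positivity
  set C₁ : ℝ := (4 * (4 * 2 ^ (d + 1) * A₁)) ^ d with hC₁
  set C₂ : ℝ := 4 / 3 * (4 * (4 * 2 ^ (d + 1) * A₁)) ^ (2 * d) * ((4 * A₁ + 2) * ((d : ℝ) * 5 ^ d)) with hC₂
  have hC₁0 : 0 ≤ C₁ := by positivity
  have hC₂0 : 0 ≤ C₂ := by positivity
  refine ⟨1 + Real.sqrt ((2 : ℝ) ^ d) * (Real.sqrt C₁ + Real.sqrt C₂), by positivity, ?_⟩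
  intro u g x m N hN hEq hg μ E hE
  have hN' : (0 : ℝ) ≤ N := by exact_mod_cast hN
  have hpos : (0 : ℝ) < ((N : ℝ) + 1) ^ d := by positivity
  have hE0 : 0 ≤ E := (Finset.sum_nonneg fun _ _ => sq_nonneg _).trans hE
  -- `m ≥ 0` from the data bound at the centre
  have hm0 : 0 ≤ m := by
    have hx : x ∈ box x (N + 2) := self_mem_box x (by linarith)
    exact (abs_nonneg _).trans (hg x hx ⟨0, hd⟩)
  have h := abs_fdiff_le_log_of_dvg_of_sum_sq hd u g x hN hEq hg μ hE
  rw [← hA₁, ← hC₁] at h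
  have eC₂ : 4 / 3 * (4 * (4 * 2 ^ (d + 1) * A₁)) ^ (2 * d) * ((4 * A₁ + 2) * ((d : ℝ) * 5 ^ d * m ^ 2)) = C₂ * m ^ 2 := by
    rw [hC₂]; ring
  rw [eC₂] at h
  -- abbreviations
  set S : ℝ := Real.sqrt (E / ((N : ℝ) + 1) ^ d) with hS
  set ℓ : ℝ := (Nat.log 2 (N + 1).toNat : ℝ) + 1 with hℓ
  have hS0 : 0 ≤ S := Real.sqrt_nonneg _
  have hℓ1 : 1 ≤ ℓ := by rw [hℓ]; have : (0 : ℝ) ≤ (Nat.log 2 (N + 1).toNat : ℝ) := Nat.cast_nonneg _; linarith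
  have h2d : 0 ≤ Real.sqrt ((2 : ℝ) ^ d) := Real.sqrt_nonneg _
  have hr1 : 0 ≤ Real.sqrt C₁ := Real.sqrt_nonneg _
  have hr2 : 0 ≤ Real.sqrt C₂ := Real.sqrt_nonneg _
  -- `√(C₁·S² + C₂·m²) ≤ √C₁·S + √C₂·m`
  have hsplit : Real.sqrt (C₁ * (E / ((N : ℝ) + 1) ^ d) + C₂ * m ^ 2) ≤ Real.sqrt C₁ * S + Real.sqrt C₂ * m := by
    have e1 : Real.sqrt (C₁ * (E / ((N : ℝ) + 1) ^ d)) = Real.sqrt C₁ * S := by rw [hS, Real.sqrt_mul hC₁0]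
    have e2 : Real.sqrt (C₂ * m ^ 2) = Real.sqrt C₂ * m := by rw [Real.sqrt_mul hC₂0, Real.sqrt_sq hm0]
    calc Real.sqrt (C₁ * (E / ((N : ℝ) + 1) ^ d) + C₂ * m ^ 2)
        ≤ Real.sqrt (C₁ * (E / ((N : ℝ) + 1) ^ d)) + Real.sqrt (C₂ * m ^ 2) := hab _ _ (by positivity) (by positivity)
      _ = Real.sqrt C₁ * S + Real.sqrt C₂ * m := by rw [e1, e2]
  have hmid : ℓ * (Real.sqrt ((2 : ℝ) ^ d) * Real.sqrt (C₁ * (E / ((N : ℝ) + 1) ^ d) + C₂ * m ^ 2)) ≤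
      ℓ * (Real.sqrt ((2 : ℝ) ^ d) * (Real.sqrt C₁ * S + Real.sqrt C₂ * m)) :=
    mul_le_mul_of_nonneg_left (mul_le_mul_of_nonneg_left hsplit h2d) (by linarith)
  have hS1 : S ≤ ℓ * S := le_mul_of_one_le_left hS0 hℓ1
  -- assemble
  have hgoal : S + ℓ * (Real.sqrt ((2 : ℝ) ^ d) * (Real.sqrt C₁ * S + Real.sqrt C₂ * m)) ≤
      (1 + Real.sqrt ((2 : ℝ) ^ d) * (Real.sqrt C₁ + Real.sqrt C₂)) * (ℓ * (m + S)) := by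
    have h1 : Real.sqrt C₁ * S + Real.sqrt C₂ * m ≤ (Real.sqrt C₁ + Real.sqrt C₂) * (m + S) := by
      have e1 : (Real.sqrt C₁ + Real.sqrt C₂) * (m + S) = (Real.sqrt C₁ * S + Real.sqrt C₂ * m) + (Real.sqrt C₁ * m + Real.sqrt C₂ * S) := by
        ring
      rw [e1]
      linarith only [mul_nonneg hr1 hm0, mul_nonneg hr2 hS0]
    have h2 : ℓ * (Real.sqrt ((2 : ℝ) ^ d) * (Real.sqrt C₁ * S + Real.sqrt C₂ * m)) ≤
        ℓ * (Real.sqrt ((2 : ℝ) ^ d) * ((Real.sqrt C₁ + Real.sqrt C₂) * (m + S))) :=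
      mul_le_mul_of_nonneg_left (mul_le_mul_of_nonneg_left h1 h2d) (by linarith only [hℓ1])
    have h3 : S ≤ ℓ * (m + S) := by
      have e3 : ℓ * (m + S) = ℓ * m + ℓ * S := by ring
      have h4 : 0 ≤ ℓ * m := mul_nonneg (by linarith only [hℓ1]) hm0
      rw [e3]
      linarith only [hS1, h4]
    have e : (1 + Real.sqrt ((2 : ℝ) ^ d) * (Real.sqrt C₁ + Real.sqrt C₂)) * (ℓ * (m + S)) =
        ℓ * (m + S) + ℓ * (Real.sqrt ((2 : ℝ) ^ d) * ((Real.sqrt C₁ + Real.sqrt C₂) * (m + S))) := by ring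
    rw [e]
    linarith only [h2, h3]
  clear_value A₁ C₁ C₂ S ℓ
  linarith only [h, hmid, hgoal]
end Summit.QuantumFields.YangMills.Theorems.PoincareLipschitzFlatRieszLogSup
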